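import Literature.NumberTheory.QuadraticFields.RealQuadraticInfrastructureDistance
import Literature.Computability.Cryptography.InfrastructureNavigation
import HarnessLib

/-!
# The principal cycle of a real quadratic order as a `GiantStepCycle`, given the giant step

Topic `Computability/Cryptography`; joins `NumberTheory/QuadraticFields/RealQuadraticInfrastructureDistance.lean`
(the principal cycle `x₁, ρx₁, …` of reduced quotients of a non-square discriminant `D ≡ 0, 1 (mod 4)`,
period `p`, gaps `gap i = log φ(ρⁱx₁)`, positions `pos m = ∑_{j<m} gap j`, `pos (m + p) = pos m + R`,
`R = log ε`) to `InfrastructureNavigation.lean` (`GiantStepCycle`: the abstract infrastructure Hallgren's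
walk runs on). Theorem-and-definition file, no named facts.

Everything a `GiantStepCycle (QuadIrr D)` asks for is supplied by the cycle files EXCEPT the giant
step and the approximate evaluators, which this file takes as a datum `StarOps D` — the exact
specification of what the arithmetic of ideal products must deliver (Jozsa 2003, §7.1, Props. 33–35;
Jacobson–Williams §5.4 and (7.28)): a product `star` of two cycle elements landing ON the cycle at the
sum of the positions plus a defect `kappa`, `|kappa| ≤ K`, up to a multiple of `R`
(`StarOps.star_spec`), together with rational evaluators of the defect and of the gaps to precision
`η ≤ 1/8` (the latter is `Complexity/CodeFPLog.lean`'s `lnQuadDyadic`, to be plugged in by the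
instance file). We construct

* `rep`, `labZ`, `posZ` — the cycle unrolled over `ℤ`: `labZ m = ρ^{m mod p} x₁`,
  `posZ m = ⌊m/p⌋ R + pos (m mod p)` (`posZ_natCast : posZ k = pos k`), strictly increasing,
  `posZ (m + p) = posZ m + R`, `labZ_eq_iff : labZ m = labZ m' ↔ p ∣ m − m'` (minimal period),
  `step (labZ m) = labZ (m + 1)`, `posZ (m + 1) − posZ m = gap (m mod p)`;
* **`giantStepCycle hD hD4 S : GiantStepCycle (QuadIrr D)`** with `unit = x₁`, `rho = step`, `R = log ε`,
  `n = p`, `G = log (2√D)` (`gap_lt`), `L = log 2` (`log_two_lt_gap_add_gap_succ`).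

## References

* R. Jozsa, *Notes on Hallgren's efficient quantum algorithm for solving Pell's equation*,
  arXiv:quant-ph/0302134 (2003), §6.3 Thm. 4, §7 Props. 31–35, §8. [Jozsa2003]
* M. J. Jacobson, Jr., H. C. Williams, *Solving the Pell Equation*, Springer (2009), §5.4, §7.4 (7.28).
  [JacobsonWilliams2008]
-/

noncomputable section

open scoped Classical

namespace Literature.Computability.Cryptography

open Literature.NumberTheory.QuadraticFields Literature.NumberTheory.QuadraticFields.QuadIrr

/-- **What the giant step must deliver** on the principal cycle of discriminant `D`: a product
`star` of cycle elements landing on the cycle at the sum of the positions plus a bounded defect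
`kappa` (up to a multiple of `R = log ε`), with rational `η`-evaluators of `kappa` and of the gaps.
[cite: Jozsa2003, §7.1 Props. 33–35 (I * J, δ(I·J) = δ(I) + δ(J), |δ(I, I_red)| < ln D)]
[cite: JacobsonWilliams2008, §7.4 eq. (7.28)] -/
structure StarOps (D : ℕ) where
  /-- the giant step -/
  star : QuadIrr D → QuadIrr D → QuadIrr D
  /-- its distance defect -/
  kappa : QuadIrr D → QuadIrr D → ℝ
  /-- a rational bound on the defects -/
  K : ℚ
  /-- computed defect -/
  khat : QuadIrr D → QuadIrr D → ℚ
  /-- computed gap after a cycle element -/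
  ghat : QuadIrr D → ℚ
  /-- precision of the evaluators -/
  η : ℝ
  /-- `η ≥ 0` -/
  η_nonneg : 0 ≤ η
  /-- `η ≤ 1/8` -/
  η_le : η ≤ 1 / 8
  /-- the product of the `i`-th and `j`-th cycle elements is the `k`-th, at distance
  `pos i + pos j + kappa − l R` -/
  star_spec : ∀ i j : ℕ, ∃ (k : ℕ) (l : ℤ),
    step^[k] (principalFirst D) = star (step^[i] (principalFirst D)) (step^[j] (principalFirst D)) ∧
      pos D k = pos D i + pos D j + kappa (step^[i] (principalFirst D)) (step^[j] (principalFirst D)) +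
        l * Real.log (fundUnit D)
  /-- defects are bounded -/
  abs_kappa_le : ∀ a b, |kappa a b| ≤ K
  /-- the defect evaluator is `η`-accurate -/
  khat_spec : ∀ a b, |(khat a b : ℝ) - kappa a b| ≤ η
  /-- the gap evaluator is `η`-accurate along the cycle -/
  ghat_spec : ∀ i : ℕ, |(ghat (step^[i] (principalFirst D)) : ℝ) - gap D i| ≤ η

namespace PrincipalCycle

variable {D : ℕ} (hD : ¬ IsSquare D) (hD4 : D % 4 = 0 ∨ D % 4 = 1)

/-! ### The cycle unrolled over `ℤ` -/

/-- The representative `m mod p ∈ [0, p)` of an unrolled index. [folklore] -/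
def rep (D : ℕ) (m : ℤ) : ℕ := (m % (periodLength D : ℤ)).toNat

/-- The cycle element of unrolled index `m`: `ρ^{m mod p} x₁`. [cite: Jozsa2003, §6.3 Thm. 4(a)] -/
def labZ (D : ℕ) (m : ℤ) : QuadIrr D := step^[rep D m] (principalFirst D)

/-- The unrolled position `⌊m/p⌋ R + pos (m mod p)`. [cite: Jozsa2003, §8 (the circle unrolled)] -/
def posZ (D : ℕ) (m : ℤ) : ℝ := ((m / (periodLength D : ℤ) : ℤ) : ℝ) * Real.log (fundUnit D) + pos D (rep D m)

include hD hD4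

/-- `p > 0` as an integer. [folklore] -/
theorem periodLength_pos_int : (0 : ℤ) < (periodLength D : ℤ) := by exact_mod_cast periodLength_pos hD hD4

/-- `rep m < p` and `m = (m/p) p + rep m`. [folklore] -/
theorem rep_spec (m : ℤ) : rep D m < periodLength D ∧ ((rep D m : ℕ) : ℤ) = m % (periodLength D : ℤ) := by
  have hp := periodLength_pos_int hD hD4
  have h0 : 0 ≤ m % (periodLength D : ℤ) := Int.emod_nonneg _ hp.ne'
  have h1 : m % (periodLength D : ℤ) < periodLength D := Int.emod_lt_of_pos _ hp
  refine ⟨?_, Int.toNat_of_nonneg h0⟩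
  unfold rep
  omega

omit hD hD4 in
/-- `rep` of a natural number is `k mod p`. [folklore] -/
theorem rep_natCast (k : ℕ) : rep D (k : ℤ) = k % periodLength D := by
  unfold rep
  rw [← Int.natCast_mod, Int.toNat_natCast]

omit hD hD4 in
/-- Positions of natural indices split along the period. [cite: Jozsa2003, §8] -/
theorem pos_eq_pos_mod_add (hD : ¬ IsSquare D) (hD4 : D % 4 = 0 ∨ D % 4 = 1) (k : ℕ) :
    pos D k = pos D (k % periodLength D) + (k / periodLength D : ℕ) * Real.log (fundUnit D) := by
  conv_lhs => rw [← Nat.mod_add_div k (periodLength D), mul_comm]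
  exact pos_add_mul_periodLength hD hD4 _ _

/-- **`posZ k = pos k` on natural numbers.** [folklore] -/
theorem posZ_natCast (k : ℕ) : posZ D (k : ℤ) = pos D k := by
  unfold posZ
  rw [rep_natCast, pos_eq_pos_mod_add hD hD4 k, ← Int.natCast_div, Int.cast_natCast]
  ring

/-- `posZ 0 = 0`. [folklore] -/
theorem posZ_zero : posZ D 0 = 0 := by
  have := posZ_natCast hD hD4 0
  simpa using this

omit hD hD4 in
/-- `labZ 0 = x₁`. [folklore] -/
theorem labZ_zero : labZ D 0 = principalFirst D := by
  unfold labZ rep; simp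

/-- **Periodicity: `posZ (m + p) = posZ m + R`.** [cite: Jozsa2003, §8] -/
theorem posZ_add_periodLength (m : ℤ) : posZ D (m + periodLength D) = posZ D m + Real.log (fundUnit D) := by
  have hp := periodLength_pos_int hD hD4
  have h1 : m + (periodLength D : ℤ) = m + 1 * (periodLength D : ℤ) := by ring
  unfold posZ rep
  rw [h1, Int.add_mul_ediv_right _ _ hp.ne', Int.add_mul_emod_self_right]
  push_cast; ring

/-- Division with remainder of the successor: either no wrap (`rep (m+1) = rep m + 1`, same
quotient) or a wrap (`rep m = p − 1`, `rep (m+1) = 0`, quotient `+1`). [folklore] -/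
theorem succ_cases (m : ℤ) :
    (rep D (m + 1) = rep D m + 1 ∧ (m + 1) / (periodLength D : ℤ) = m / (periodLength D : ℤ)) ∨
      (rep D m + 1 = periodLength D ∧ rep D (m + 1) = 0 ∧
        (m + 1) / (periodLength D : ℤ) = m / (periodLength D : ℤ) + 1) := by
  have hp := periodLength_pos_int hD hD4
  obtain ⟨hlt, hrep⟩ := rep_spec hD hD4 m
  set p : ℤ := (periodLength D : ℤ) with hpdef
  set q : ℤ := m / p with hq
  set r : ℕ := rep D m with hr
  have hm : m = (r : ℤ) + p * q := by
    have := Int.emod_add_mul_ediv m p   -- m % p + p * (m / p) = m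
    rw [← hrep] at this; linarith
  by_cases hwrap : r + 1 < periodLength D
  · left
    have key : (m + 1) / p = q ∧ (m + 1) % p = (r : ℤ) + 1 := by
      rw [Int.ediv_emod_unique hp]
      refine ⟨by rw [hm]; ring, by positivity, by push_cast [hpdef]; exact_mod_cast hwrap⟩
    refine ⟨?_, key.1⟩
    show ((m + 1) % p).toNat = r + 1
    rw [key.2, show ((r : ℤ) + 1) = ((r + 1 : ℕ) : ℤ) by push_cast; ring, Int.toNat_natCast]
  · right
    have hr1 : r + 1 = periodLength D := by omega
    have key : (m + 1) / p = q + 1 ∧ (m + 1) % p = 0 := by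
      rw [Int.ediv_emod_unique hp]
      refine ⟨?_, le_rfl, hp⟩
      rw [hm, hpdef]
      have : ((r : ℤ) + 1) = (periodLength D : ℤ) := by exact_mod_cast hr1
      linear_combination -this
    refine ⟨hr1, ?_, key.1⟩
    show ((m + 1) % p).toNat = 0
    rw [key.2]; rfl

/-- **Consecutive positions differ by a gap**: `posZ (m + 1) − posZ m = gap (rep m)`. [cite: Jozsa2003, §7 Prop. 31] -/
theorem posZ_succ_sub (m : ℤ) : posZ D (m + 1) - posZ D m = gap D (rep D m) := by
  rcases succ_cases hD hD4 m with ⟨hrep, hq⟩ | ⟨hr1, hrep, hq⟩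
  · unfold posZ
    rw [hrep, hq, pos_succ]; ring
  · unfold posZ
    rw [hrep, hq, pos_zero]
    have hR : Real.log (fundUnit D) = pos D (rep D m) + gap D (rep D m) := by
      rw [← pos_succ, hr1, pos_periodLength hD hD4]
    push_cast
    linarith

/-- **`posZ` is strictly increasing.** [cite: Jozsa2003, §8] -/
theorem posZ_strictMono : StrictMono (posZ D) := by
  apply strictMono_int_of_lt_succ
  intro m
  have h := posZ_succ_sub hD hD4 m
  have hg := gap_pos hD hD4 (rep D m)
  linarith

/-- `posZ (m + l p) = posZ m + l R`. [cite: Jozsa2003, §8] -/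
theorem posZ_add_mul_periodLength (m l : ℤ) :
    posZ D (m + l * periodLength D) = posZ D m + l * Real.log (fundUnit D) := by
  induction l using Int.induction_on with
  | zero => simp
  | succ i ih =>
    rw [show m + (i + 1) * (periodLength D : ℤ) = (m + i * periodLength D) + periodLength D by ring,
      posZ_add_periodLength hD hD4, ih]
    push_cast; ring
  | pred i ih =>
    have h := posZ_add_periodLength hD hD4 (m + (-(i : ℤ) - 1) * periodLength D)
    rw [show m + (-(i : ℤ) - 1) * (periodLength D : ℤ) + periodLength D = m + (-(i : ℤ)) * periodLength D by ring,
      ih] at h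
    push_cast at h ⊢
    linarith

/-- **Labels name ideals**: `labZ m = labZ m' ↔ p ∣ m − m'` (the period is minimal).
[cite: Jozsa2003, §6.3 Thm. 4(a) (J_i = J_j iff i ≡ j mod k₀)] -/
theorem labZ_eq_iff (m m' : ℤ) : labZ D m = labZ D m' ↔ (periodLength D : ℤ) ∣ m - m' := by
  obtain ⟨h1, h1'⟩ := rep_spec hD hD4 m
  obtain ⟨h2, h2'⟩ := rep_spec hD hD4 m'
  unfold labZ
  rw [Function.iterate_eq_iterate_iff_of_lt_minimalPeriod (by exact h1) (by exact h2),
    ← Nat.cast_inj (R := ℤ), h1', h2']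
  exact Int.modEq_iff_dvd.trans dvd_sub_comm

/-- **The baby step moves to the next label**: `step (labZ m) = labZ (m + 1)`. [cite: Jozsa2003, §6.3 (J_{i+1} = ρ(J_i))] -/
theorem step_labZ (m : ℤ) : step (labZ D m) = labZ D (m + 1) := by
  unfold labZ
  rw [← Function.iterate_succ_apply' step]
  show step^[rep D m + 1] (principalFirst D) = step^[rep D (m + 1)] (principalFirst D)
  rcases succ_cases hD hD4 m with ⟨hrep, -⟩ | ⟨hr1, hrep, -⟩
  · rw [hrep]
  · rw [hrep, hr1, Function.iterate_zero_apply]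
    exact iterate_periodLength_principalFirst

omit hD hD4 in
/-- Labels of natural indices. [folklore] -/
theorem labZ_natCast (k : ℕ) : labZ D (k : ℤ) = step^[k] (principalFirst D) := by
  unfold labZ
  rw [rep_natCast]
  exact Function.iterate_mod_minimalPeriod_eq

/-- **Two consecutive gaps along the unrolled cycle exceed `log 2`.** [cite: Jozsa2003, §7 Prop. 32] -/
theorem log_two_lt_posZ_add_two_sub (m : ℤ) : Real.log 2 < posZ D (m + 2) - posZ D m := by
  have h1 := posZ_succ_sub hD hD4 m
  have h2 := posZ_succ_sub hD hD4 (m + 1)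
  rw [show m + 1 + 1 = m + 2 by ring] at h2
  have hgap : gap D (rep D (m + 1)) = gap D (rep D m + 1) := by
    rcases succ_cases hD hD4 m with ⟨hrep, -⟩ | ⟨hr1, hrep, -⟩
    · rw [hrep]
    · rw [hrep, hr1, ← gap_add_periodLength 0, zero_add]
  have := log_two_lt_gap_add_gap_succ hD hD4 (rep D m)
  linarith

/-! ### The instance -/

/-- **The principal cycle is a `GiantStepCycle`** (given the giant step `S : StarOps D`): unit `x₁`,
baby step `ρ = step`, positions `posZ`, labels `labZ`, `R = log ε`, `n = p`, `G = log (2√D)`,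
`L = log 2`, evaluators and defect from `S`. [cite: Jozsa2003, §7–§8] [cite: JacobsonWilliams2008, §7.4] -/
def giantStepCycle (S : StarOps D) : GiantStepCycle (QuadIrr D) where
  unit := principalFirst D
  rho := step
  star := S.star
  ghat := S.ghat
  khat := S.khat
  K := S.K
  R := Real.log (fundUnit D)
  n := periodLength D
  P := posZ D
  lab := labZ D
  kappa := S.kappa
  η := S.η
  G := Real.log (2 * Real.sqrt D)
  L := Real.log 2
  n_pos := periodLength_pos hD hD4
  strictMono := posZ_strictMono hD hD4
  P_zero := posZ_zero hD hD4
  lab_zero := labZ_zero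
  periodic := posZ_add_periodLength hD hD4
  lab_eq_iff := labZ_eq_iff hD hD4
  rho_lab := step_labZ hD hD4
  star_lab := by
    intro m₁ m₂
    have hp := periodLength_pos_int hD hD4
    -- reduce to the representatives
    obtain ⟨k, l, hk, hpos⟩ := S.star_spec (rep D m₁) (rep D m₂)
    set q₁ : ℤ := m₁ / (periodLength D : ℤ)
    set q₂ : ℤ := m₂ / (periodLength D : ℤ)
    refine ⟨(k : ℤ) + (q₁ + q₂ - l) * periodLength D, ?_, ?_⟩
    · -- label
      have hl : labZ D ((k : ℤ) + (q₁ + q₂ - l) * periodLength D) = labZ D (k : ℤ) :=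
        (labZ_eq_iff hD hD4 _ _).mpr ⟨q₁ + q₂ - l, by ring⟩
      rw [hl, labZ_natCast, hk]
      rfl
    · -- position
      rw [posZ_add_mul_periodLength hD hD4, posZ_natCast hD hD4, hpos]
      unfold posZ labZ
      push_cast
      ring
  abs_kappa_le := S.abs_kappa_le
  ghat_spec := by
    intro m
    have h := S.ghat_spec (rep D m)
    rw [← posZ_succ_sub hD hD4 m] at h
    exact h
  khat_spec := S.khat_spec
  η_nonneg := S.η_nonneg
  η_le := S.η_le
  gap_le := by
    intro m
    have h := posZ_succ_sub hD hD4 m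
    have := gap_lt hD hD4 (rep D m)
    linarith
  two_gap := fun m => (log_two_lt_posZ_add_two_sub hD hD4 m).le
  L_gt := by
    have := S.η_le
    have h2 := Real.one_sub_inv_le_log_of_pos (by norm_num : (0 : ℝ) < 2)
    norm_num at h2
    linarith

/-- The instance's circumference is the regulator `log ε` (`= R_K` for the field, by
`RealQuadraticRegulator.regulator_eq_log_fundUnit`). [cite: Jozsa2003, §6.3 Thm. 4(b)] -/
@[simp] theorem giantStepCycle_R (S : StarOps D) : (giantStepCycle hD hD4 S).R = Real.log (fundUnit D) := rfl

/-- The instance's unit is `x₁` and its baby step is `ρ = step`. [folklore] -/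
theorem giantStepCycle_unit_rho (S : StarOps D) :
    (giantStepCycle hD hD4 S).unit = principalFirst D ∧ (giantStepCycle hD hD4 S).rho = step := ⟨rfl, rfl⟩

end PrincipalCycle

end Literature.Computability.Cryptography

end
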